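import Summits.QuantumAdvantage.AdviceFreeQNC0.InducedStrategy
import Summits.QuantumAdvantage.AdviceFreeQNC0.CrossTeamEmbedding
import HarnessLib

/-!
# Cell qa-qnc0 (rung F-Q1, route RingFrame, crux α): the product bound for the GENUINE pair of a
# walk strategy, with LDMA only for its own three rows (planner qa-qnc0-p1 ROUND-9 §6b, T7, ask P10)

`agree_ge_of_ldma` (`ProductGameSmallBlocks.lean`) needs weighted residue non-avoidance (LDMA) for
EVERY column-degree-`D` map.  Here the same proof is run with EXPLICIT column stakes
(`agree_ge_of_ldma_stakes`, = Sketch10 `agree_ge_genuine`): LDMA is required only for the three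
zero-sum-triple maps `stakesRow A B r` built from the given stakes `(A, B)`.  For the genuine pair
`(win1 cc (F1 y), win0 cc (F0 y))` of a walk strategy `y` on `L + L'` bits, the class-`0` stakes of
team 1's columns are explicit in the profile `F1 y` (`win1_eq_stakes`), which factors through the
induced strategy on Bob's cube (`F1_eq_of_induced_eq`); so the three rows are constant on the atoms
of `induced y`, of degree `≤ D(L'+1)#Ball(L',D)` (`hasDeg_induced_atom`), and PLDAMS at THAT degree
suffices (`agree_ge_genuine`).  Packaged with the three-mode XOR law and the block embedding:

* `card_ringWinU_le_of_budget`: if PLDAMS holds on Alice's `L` bits at degree `D(L'+1)#Ball(L',D)`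
  with constant `κ` and Bob's minimum fail weight is `≥ η·2^{L'}`, then EVERY charge-`cc` walk
  strategy of degree `≤ D` on `L + L'` bits wins on `≤ (1 − κη)·2^{L+L'}` inputs.

The growth arithmetic turning this into Sketch10 `WalkHardLogOverLogLog` is in
`WalkHardLogOverLogLog.lean`.  WHAT THIS IS NOT: nothing at polylog degree; α untouched.
-/

noncomputable section

namespace Summit.QuantumAdvantage.AdviceFreeQNC0

open Finset
open Literature.Computability.MetaComplexity Literature.Computability.MetaComplexity.Smolensky

variable {L L' : ℕ}

/-! ### The product bound with explicit stakes -/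

/-- The zero-sum triple of rows read off the column stakes `(A v, B v)`: `Γ_r(u)(v) = g_r(A v u, B v u)`. -/
def stakesRow (A B : (Fin L' → Bool) → (Fin L → Bool) → Bool) (r : Fin 3) (u : Fin L → Bool) :
    (Fin L' → Bool) → Bool :=
  fun v => triple r (A v u) (B v u)

/-- **`stub_product` with explicit stakes** (the proof of `agree_ge_of_ldma`, with LDMA asked only for
the three maps `stakesRow A B r`; the stakes' degree is not even needed). -/
theorem agree_ge_of_ldma_stakes {κ η : ℝ} (hκ : 0 ≤ κ) {D : ℕ}
    (A B : (Fin L' → Bool) → (Fin L → Bool) → Bool)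
    (hL : ∀ r : Fin 3, ∀ s : ℕ, κ * ((∑ u : Fin L → Bool, distFail D (stakesRow A B r u) : ℕ) : ℝ) ≤
      ((∑ u ∈ univ.filter (fun u : Fin L → Bool => wt u % 3 = s % 3),
        distFail D (stakesRow A B r u) : ℕ) : ℝ))
    (hw : η * (2 : ℝ) ^ L' ≤ (distFail D (fun _ : Fin L' → Bool => false) : ℝ))
    (X Y : (Fin L → Bool) → (Fin L' → Bool) → Bool)
    (hX : ∀ u v, X u v = !(elimFail 0 (A v) (B v) u)) (hY : ∀ u, IsElimWin D (fun v => Y u v)) :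
    κ * η * (2 : ℝ) ^ (L + L') ≤ (agreeCountR X Y : ℝ) := by
  classical
  set Γ : Fin 3 → (Fin L → Bool) → (Fin L' → Bool) → Bool := fun r u v => triple r (A v u) (B v u) with hΓ
  have hXΓ : ∀ u v, X u v = Γ (resLabel u) u v := fun u v => by
    rw [hX u v]
    unfold elimFail
    rw [win_eq_triple]
  -- Bob's fail pattern in row `u`
  have hYf : ∀ u, IsElimFail D (fun v => !(Y u v)) := by
    intro u
    obtain ⟨c, a, b, ha, hb, h⟩ := hY u
    refine ⟨c, a, b, ha, hb, fun v => ?_⟩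
    have hv : Y u v = !elimFail c a b v := h v
    show (!Y u v) = elimFail c a b v
    rw [hv, Bool.not_not]
  -- row decomposition
  have hrow : ∀ u, distFail D (Γ (resLabel u) u) ≤ (univ.filter fun v => X u v = Y u v).card := by
    intro u
    refine le_trans (distFail_le _ (hYf u)) (le_of_eq ?_)
    unfold hdist
    congr 1
    ext v
    simp only [mem_filter, mem_univ, true_and, hXΓ u v]
    cases Γ (resLabel u) u v <;> cases Y u v <;> decide
  have hagree : agreeCountR X Y = ∑ u, (univ.filter fun v => X u v = Y u v).card := by
    unfold agreeCountR
    exact card_filter_prod_eq_sum (fun u v => X u v = Y u v)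
  -- LDMA, one residue at a time (only for the three `Γ r`)
  have hLr : ∀ r : Fin 3, κ * ∑ u : Fin L → Bool, (distFail D (Γ r u) : ℝ) ≤
      ∑ u ∈ univ.filter (fun u => resLabel u = r), (distFail D (Γ r u) : ℝ) := by
    intro r
    have h := hL r ((3 - r.val) % 3)
    have hset : (univ.filter fun u : Fin L → Bool => wt u % 3 = ((3 - r.val) % 3) % 3) =
        univ.filter fun u => resLabel u = r := by
      ext u
      simp only [mem_filter, mem_univ, true_and, resLabel, Fin.ext_iff]
      have := r.isLt
      omega
    rw [hset] at h
    push_cast at h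
    exact h
  -- potential costs
  have hpc : ∀ u : Fin L → Bool, (distFail D (fun _ : Fin L' → Bool => false) : ℝ) ≤
      (distFail D (Γ 0 u) : ℝ) + distFail D (Γ 1 u) + distFail D (Γ 2 u) := fun u => by
    exact_mod_cast potential_cost D _ _ _ fun v => triple_sum (A v u) (B v u)
  -- assembling the chain
  have h1 : (∑ u : Fin L → Bool, (distFail D (Γ (resLabel u) u) : ℝ)) ≤ (agreeCountR X Y : ℝ) := by
    rw [hagree]
    push_cast
    exact Finset.sum_le_sum fun u _ => by exact_mod_cast hrow u
  have h2 : (∑ u : Fin L → Bool, (distFail D (Γ (resLabel u) u) : ℝ)) =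
      ∑ r : Fin 3, ∑ u ∈ univ.filter (fun u => resLabel u = r), (distFail D (Γ r u) : ℝ) := by
    rw [← Finset.sum_fiberwise_of_maps_to (s := (univ : Finset (Fin L → Bool)))
      (t := (univ : Finset (Fin 3))) (g := resLabel) (fun u _ => mem_univ _)
      (f := fun u => (distFail D (Γ (resLabel u) u) : ℝ))]
    refine Finset.sum_congr rfl fun r _ => Finset.sum_congr rfl fun u hu => ?_
    rw [(Finset.mem_filter.1 hu).2]
  have h4 : ∑ r : Fin 3, ∑ u : Fin L → Bool, (distFail D (Γ r u) : ℝ) =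
      ∑ u : Fin L → Bool, ((distFail D (Γ 0 u) : ℝ) + distFail D (Γ 1 u) + distFail D (Γ 2 u)) := by
    rw [Finset.sum_comm]
    refine Finset.sum_congr rfl fun u _ => ?_
    rw [Fin.sum_univ_three]
  have hcard : (∑ _u : Fin L → Bool, (distFail D (fun _ : Fin L' → Bool => false) : ℝ)) =
      (2 : ℝ) ^ L * (distFail D (fun _ : Fin L' → Bool => false) : ℝ) := by
    rw [Finset.sum_const, card_univ, Fintype.card_fun, Fintype.card_bool, Fintype.card_fin,
      nsmul_eq_mul]
    push_cast
    ring
  calc κ * η * (2 : ℝ) ^ (L + L')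
      = κ * ((2 : ℝ) ^ L * (η * (2 : ℝ) ^ L')) := by rw [pow_add]; ring
    _ ≤ κ * ((2 : ℝ) ^ L * (distFail D (fun _ : Fin L' → Bool => false) : ℝ)) := by
        have h2L : (0 : ℝ) ≤ (2 : ℝ) ^ L := by positivity
        exact mul_le_mul_of_nonneg_left (mul_le_mul_of_nonneg_left hw h2L) hκ
    _ = κ * ∑ _u : Fin L → Bool, (distFail D (fun _ : Fin L' → Bool => false) : ℝ) := by rw [hcard]
    _ ≤ κ * ∑ u : Fin L → Bool, ((distFail D (Γ 0 u) : ℝ) + distFail D (Γ 1 u) + distFail D (Γ 2 u)) :=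
        mul_le_mul_of_nonneg_left (Finset.sum_le_sum fun u _ => hpc u) hκ
    _ = ∑ r : Fin 3, κ * ∑ u : Fin L → Bool, (distFail D (Γ r u) : ℝ) := by
        rw [← h4, Finset.mul_sum]
    _ ≤ ∑ r : Fin 3, ∑ u ∈ univ.filter (fun u => resLabel u = r), (distFail D (Γ r u) : ℝ) :=
        Finset.sum_le_sum fun r _ => hLr r
    _ = ∑ u : Fin L → Bool, (distFail D (Γ (resLabel u) u) : ℝ) := h2.symm
    _ ≤ (agreeCountR X Y : ℝ) := h1

/-! ### The genuine pair: explicit class-`0` stakes -/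

/-- Team 1's class-`0` column stakes, read off the profile `F1 y`. -/
def stakeA (cc : ℕ) (y : Fin (L + L' + 1) → (Fin (L + L') → Bool) → Bool) (v : Fin L' → Bool)
    (u : Fin L → Bool) : Bool :=
  (rot0 (cc + wt v) (xor (F1 y v u).1 (F1 y v u).2) (F1 y v u).2).1

/-- Team 1's class-`0` column stakes, read off the profile `F1 y` (second stake). -/
def stakeB (cc : ℕ) (y : Fin (L + L' + 1) → (Fin (L + L') → Bool) → Bool) (v : Fin L' → Bool)
    (u : Fin L → Bool) : Bool :=
  (rot0 (cc + wt v) (xor (F1 y v u).1 (F1 y v u).2) (F1 y v u).2).2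

/-- `win1` in class-`0` form with the explicit stakes. -/
theorem win1_eq_stakes (cc : ℕ) (y : Fin (L + L' + 1) → (Fin (L + L') → Bool) → Bool)
    (u : Fin L → Bool) (v : Fin L' → Bool) :
    win1 cc (F1 y) u v = !(elimFail 0 (stakeA cc y v) (stakeB cc y v) u) := by
  unfold win1 elimFail stakeA stakeB
  rw [elimFailBits_rot0 (cc + wt v)]

/-- The stakes have degree `≤ D`. -/
theorem hasDeg_stakeA {D : ℕ} (cc : ℕ) (y : Fin (L + L' + 1) → (Fin (L + L') → Bool) → Bool)
    (hy : ∀ g, HasDeg (y g) D) (v : Fin L' → Bool) : HasDeg (stakeA cc y v) D := by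
  have h := crossDeg_F1 y hy v
  exact hasDeg_rot0_fst (cc + wt v) (hasDeg_xor h.1 h.2) h.2

/-- The stakes have degree `≤ D` (second stake). -/
theorem hasDeg_stakeB {D : ℕ} (cc : ℕ) (y : Fin (L + L' + 1) → (Fin (L + L') → Bool) → Bool)
    (hy : ∀ g, HasDeg (y g) D) (v : Fin L' → Bool) : HasDeg (stakeB cc y v) D := by
  have h := crossDeg_F1 y hy v
  exact hasDeg_rot0_snd (cc + wt v) (hasDeg_xor h.1 h.2) h.2

/-- The three genuine rows are constant on the atoms of the induced strategy. -/
theorem stakesRow_eq_of_induced_eq (cc : ℕ) (y : Fin (L + L' + 1) → (Fin (L + L') → Bool) → Bool)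
    (r : Fin 3) {u u' : Fin L → Bool} (h : induced y u = induced y u') :
    stakesRow (stakeA cc y) (stakeB cc y) r u = stakesRow (stakeA cc y) (stakeB cc y) r u' := by
  funext v
  unfold stakesRow stakeA stakeB
  rw [F1_eq_of_induced_eq y h v]

/-- **The genuine product bound** (Sketch10 `agree_ge_genuine`): PLDAMS on Alice's cube at the
ATOM DEGREE `D(L'+1)#Ball(L',D)` and Bob's minimum fail weight give `κη·2^{L+L'}` lost cells for the
genuine pair of every degree-`D` walk strategy at every charge. -/
theorem agree_ge_genuine {κ η : ℝ} (hκ : 0 ≤ κ) {D : ℕ} (cc : ℕ)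
    (y : Fin (L + L' + 1) → (Fin (L + L') → Bool) → Bool) (hy : ∀ g, HasDeg (y g) D)
    (hP : ∀ g : CubeFn (ZMod 2) L, g ∈ lowDeg (ZMod 2) L (D * ((L' + 1) * (ball L' D).card)) →
      ∀ r : ℕ, κ * ((univ.filter fun u : Fin L → Bool => g u ≠ 0).card : ℝ) ≤
        ((univ.filter fun u : Fin L → Bool => g u ≠ 0 ∧ wt u % 3 = r % 3).card : ℝ))
    (hw : η * (2 : ℝ) ^ L' ≤ (distFail D (fun _ : Fin L' → Bool => false) : ℝ)) :
    κ * η * (2 : ℝ) ^ (L + L') ≤ (agreeCountR (win1 cc (F1 y)) (win0 cc (F0 y)) : ℝ) := by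
  refine agree_ge_of_ldma_stakes hκ (stakeA cc y) (stakeB cc y) (fun r s => ?_) hw _ _
    (win1_eq_stakes cc y) (isElimWin_win0 cc (crossDeg_F0 y hy))
  exact ldma_of_pldams_fibres hP (induced y) (hasDeg_induced_atom y hy)
    (fun u => distFail D (stakesRow (stakeA cc y) (stakeB cc y) r u))
    (fun u u' h => by rw [stakesRow_eq_of_induced_eq cc y r h]) s

/-! ### The walk game at fixed cut, under the PLDAMS / fail-weight budget -/

/-- **The walk game is hard whenever the budget is met**: with PLDAMS on `L` bits at the atom degree
`D(L'+1)#Ball(L',D)` (constant `κ`) and Bob's minimum fail weight `≥ η·2^{L'}` at degree `D`, every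
charge-`cc` walk strategy of degree `≤ D` on `L + L'` bits wins on at most `(1 − κη)·2^{L+L'}` inputs. -/
theorem card_ringWinU_le_of_budget {κ η : ℝ} (hκ : 0 ≤ κ) {D : ℕ} (cc : ℕ)
    (y : Fin (L + L' + 1) → (Fin (L + L') → Bool) → Bool) (hy : ∀ g, HasDeg (y g) D)
    (hP : ∀ g : CubeFn (ZMod 2) L, g ∈ lowDeg (ZMod 2) L (D * ((L' + 1) * (ball L' D).card)) →
      ∀ r : ℕ, κ * ((univ.filter fun u : Fin L → Bool => g u ≠ 0).card : ℝ) ≤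
        ((univ.filter fun u : Fin L → Bool => g u ≠ 0 ∧ wt u % 3 = r % 3).card : ℝ))
    (hw : η * (2 : ℝ) ^ L' ≤ (distFail D (fun _ : Fin L' → Bool => false) : ℝ)) :
    ((univ.filter fun w : Fin (L + L') → Bool => ringWinU cc y w = true).card : ℝ) ≤
      (1 - κ * η) * (2 : ℝ) ^ (L + L') := by
  have hagree := agree_ge_genuine hκ cc y hy hP hw
  have htot : (crossWinCount cc (F0 y) (F1 y) : ℝ) + (agreeCountR (win1 cc (F1 y)) (win0 cc (F0 y)) : ℝ) =
      (2 : ℝ) ^ (L + L') := by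
    exact_mod_cast crossWinCount_add_agree cc (F0 y) (F1 y)
  rw [card_ringWinU_eq]
  linarith

end Summit.QuantumAdvantage.AdviceFreeQNC0

end
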